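import Summits.BirchSwinnertonDyer.BirchSwinnertonDyer.Theses.DerivedKatoValuationDoor
import Literature.NumberTheory.EllipticCurves.IwasawaAlgebraDivisibilityProofs
import Literature.NumberTheory.EllipticCurves.IwasawaAlgebraCharIdealProofs
import Literature.NumberTheory.EllipticCurves.NonEisensteinPrimeOfSurjective

/-!
# Disproof of `DerivedKatoDoor` (stmt-BirchSwinnertonDyer-23024) — findings

Standing disprover's work file (refuter-cdisprove-stmt-BirchSwinnertonDyer-23024-g0-0, cycle 1,
2026-08-28). Crux (route `DerivedKatoValuationDoor`, item 23024, VERBATIM over pinned decls):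
`∀ W [IsElliptic] [IsGloballyMinimal] p [Fact p.Prime] [ContinuousSMul ℤ_[p] (W.tateModule p)],
W.analyticRank = 2 → (5 ≤ p ∧ IsOrdinaryAt W p ∧ W.HasSurjectiveModNGaloisRep p) →
∀ K (hK : K.IsCyclotomic) γ (I : IwasawaH1Data W p K γ) (z₀ : I.H), K.IsTopGenerator γ →
IsAdmissibleZetaClass W p K hK I z₀ → ¬ ∃ h m, (p ^ m) • z₀ = X ^ 2 • h`
("D-K₂": at a door prime of an analytic-rank-two curve no admissible Kato zeta class is `T²`-divisible
in `𝐇¹ ⊗ ℚ`, i.e. `v_T(z₀) ≤ 1`).  BSD is not proved by any of this.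

VERDICT (cycle 1): NO KILL.  Why it resists:
* Lean level — every instance of the hypotheses needs (a) `W.analyticRank = 2` for a CONCRETE curve
  (`analyticOrderNatAt` of a chosen entire continuation: no evaluation path) and (b) an ADMISSIBLE class
  (`IsAdmissibleZetaClass`, a closed value-pinned body whose realisability is print-only — route item
  `AdmissibleZetaClassExists`, P-a).  The datum `IwasawaH1Data` is pinned to genuine cohomology
  (`proj_injective`/`proj_surjective`), so no junk model (`H = 0`, a cooked `Λ`-action) can be cooked:
  the only definitional lever of the conclusion is `z₀ = 0` (`0 = X² • 0`, §1), and `0` is never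
  admissible at a good prime (tree: `IsAdmissibleZetaClass.ne_zero_of_forall_not_dvd_level`, Rohrlich).
* Paper level — write `s` = `ℤ_p`-rank of the STRICT part of `H¹(ℤ[1/S], T_pE)` (integral classes with
  `loc_p ≡ 0 mod p^k ∀ k`; `s = rank_{ℤ_p} H²(ℤ_S, T)`), `v = v_T(z₀)`.  PRINT: `v ≥ s` (Kato's
  divisibility Thm. 12.5/17.4 + `𝐇² ↠ H²(ℤ_S,T)_tf`; this is the proof of [BKS19, Prop. 4.5], arXiv
  p0016) and, with the cyclotomic IMC at door primes [BCS24, Thm. 1.1.2], `v = ℓ_T(𝐇²) = ℓ_T(X₀)`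
  `= s + δ`, `δ ≥ 0` the non-semisimplicity excess of the `T`-primary part of the dual fine Selmer group
  `X₀(E/ℚ_∞)`.  At `a = 2` one rational point gives `s = s_p − 1`, so BSD (+ `Ш[p^∞]` finite) gives
  `s = 1` and `v = 1 + δ`: the crux ⟺ `δ = 0` ⟺ the `T`-part of `X₀` is ONE block `Λ/T`
  (FineSemisimple₁).  The two kill mechanisms are therefore: (K-i) `s ≥ 2` at an `a = 2` door prime —
  BSD-VIOLATING (`s_p ≥ 3`), typed in §2 via the route's own support P1; (K-ii) a `T²`-Jordan block in
  `X₀(E/ℚ_∞)` at a door prime of a rank-two curve — BSD-CONSISTENT, = failure of Greenberg's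
  semisimplicity conjecture for the fine Selmer dual ([KP07] = Kurihara–Pollack, Problem 0.7 (book PDF
  p0352) and §3.1 Prop. 3.1 / Problem 3.2 (pp. 0372–0374); [Lim22, Conj. 4.2, arXiv p0011]: "very
  little evidence in literature", p0012), typed in §3 over the lower line's vocabulary `ℓ_T`.  No
  example of (K-ii) is in print; Lim's criterion `λ(X) = corank Sel(E/ℚ_n)` proves semisimplicity in
  Wuthrich's computed cases (5692A1 at p = 3, rank 2).  DATA: E-S0-1 PASS 1a (j314427): 21 680 cells
  (N < 10⁴ rank-2 classes × good ordinary odd p ≤ 47) with `A = ord_T L_p = 2`, 0 cells with `A > 2`;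
  since `A = v + w` (`𝐇¹ = Λc` free of rank one at a door prime, Kato Thm. 12.4 (3); `L_p = Col(loc_p 𝐳_γ)`,
  Kato Thm. 16.6; `w := ord_T Col(loc_p c)`) with `v ≥ s ≥ 1` (two points) and `w ≥ 1` (every global
  class is Selmer once a rational point has non-torsion `loc_p`), `A = 2` forces `v = 1`: the door HOLDS
  in every certified cell with `ρ̄` onto, unconditionally modulo the certified numerics — no IMC needed
  for this reading.  The director's ruling applies: mutate hypotheses, not instances.

LOAD-BEARING ANALYSIS (§2; "any proof must use H" ⟺ the mutant without H is false):
* `W.analyticRank = 2` → `2 ≤ W.analyticRank` (`DerivedKatoDoorFromTwo`): FALSE in print — at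
  `a = 3` (5077a) three points give `s ≥ 2`, so `v ≥ 2` by BKS Prop. 4.5; Lean:
  `derivedKatoDoorFromTwo_false_of_strictIndependentPair` (modulo P1 + the instance).  LOAD-BEARING.
* exponent `2` → `1` («v = 0 at a = 2», `DerivedKatoDoorStrongZero`, a STRENGTHENING,
  `derivedKatoDoor_of_strongZero`): FALSE in print at every rank-two curve and door prime (two points
  give `s ≥ 1`, so `v ≥ 1`; e.g. (389a1, 5)); Lean: `derivedKatoDoorStrongZero_false_of`
  (modulo (★₀) + the instance).  The exponent is TIGHT.
* `IsOrdinaryAt W p` (good ordinary) dropped (`DerivedKatoDoorWithoutOrdinary`): NO counterexample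
  mechanism — `v` is the strict/fine side; the split-multiplicative trivial zero sits in the Coleman
  side (`ρ_p = v + w`, `w = 2` there), and at supersingular `p` the fine dual is still torsion (Kato
  12.4) with the same prediction `v = s = 1`.  POSSIBLY UNNECESSARY for the crux; load-bearing only for
  LINE stubs importing the ordinary IMC / Coleman maps (lower L2 via BCS; birth's sandwich).
* `W.HasSurjectiveModNGaloisRep p` dropped (`DerivedKatoDoorWithoutSurjective`): beware VACUITY — off
  the big-image locus `𝐳_γ ∉ 𝐇¹` can happen (Wuthrich 2014 integrality examples) and then NO class is
  admissible, so the mutant holds vacuously there; where an admissible class exists the prediction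
  `v = s` is unchanged (IMC known in most Eisenstein cases).  No counterexample mechanism; the
  hypothesis is load-bearing for P-a (realisability) and for integrality in Kato 12.5 (4), not for the
  valuation claim.
* `5 ≤ p` dropped: `p = 2` is fenced by the admissible body itself (`ne_two_of_isAdmissibleZetaClass`);
  `p = 3` with `ρ_{3^∞} ⊇ SL₂(ℤ₃)` carries the same prediction.  Convenience hypothesis (Serre: for
  `p ≥ 5`, `ρ̄` onto ⇒ `ρ ⊇ SL₂(ℤ_p)`).
* `IsGloballyMinimal`: normalisation only (`closes` transports to a minimal model).

LINES (§4): PICKED = `lower` (2026-08-28T18:55Z; `Lines/lower.lean` 2415d15459c5): L1 algebra (true,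
also in the junk regime `ℓ_T = ⊤`), L2 print (BCS IMC + Kato 17.13 + 12.5), L3 OPEN = `ℓ_T(X₀) ≤ 1`;
§4 types the L3 kill ((K-ii) verbatim) and shows L3 ≡ crux modulo print in BOTH directions (no gap
smuggled by `DerivedKatoDoor_of`, no excess content): `lowerL3_false_of_fineLength_two`,
`not_lowerL3_of_not_derivedKatoDoor`.  Rung L4 = the crux at (389a1, 5): atlas row `v_T = 1`, binders
satisfiable (Δ = 389 squarefree ⇒ minimal; `a_5 = −3` good ordinary; image maximal at 5).  Alternative
`birth`: its open stub `ord_T L_p ≤ 2` is crux ∧ C₂' ∧ ε modulo print (critic V#16/#20) — strictly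
MORE than the crux; it keeps good reduction, so the split-multiplicative trivial zero (`w = 2`) does not
bite it.  Targets (lead's STUCK list): none posted yet.

References: [BKS19] = [cite: BurnsKuriharaSano2019, Prop. 4.5 and Lemma 6.12];
[Kato04] = [cite: Kato2004Asterisque, Thm. 12.4 (p. 221), Thm. 12.5 (pp. 221–222), Conj. 12.10 (p. 224), §17.13 (p. 279)];
[BCS24] = [cite: BurungaleCastellaSkinner2024, Thm. 1.1.2]; [KP07] = [cite: KuriharaPollack2007, Problem 0.7 and §3.1];
[Lim22] = [cite: Lim2022OrderVanishing, Conj. 4.2 and Lemma 4.4]; [Gr99] = [cite: GreenbergLNM1716, Conj. 1.12–1.13];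
[Wu07] = [cite: Wuthrich2007JAG, §§9–10].
-/

set_option linter.dupNamespace false

noncomputable section

namespace Summit.BirchSwinnertonDyer.BirchSwinnertonDyer.Cruxes.DerivedKatoDoor.Disproof

open Literature Literature.NumberTheory.GaloisRepresentations
open Literature.NumberTheory.EllipticCurves Literature.NumberTheory.EllipticCurves.Kato2004
open Literature.NumberTheory.EllipticCurves.Kato2004.EulerSystemValues
open Summit.BirchSwinnertonDyer.BirchSwinnertonDyer.Theses.DerivedKatoValuationDoor

/-! ## §0 Vocabulary (documentation `def`s of this work file; the landed negative lemmas spell them out) -/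

/-- **Door prime** `(W, p)`: `5 ≤ p`, good ordinary, `ρ̄_{E,p}` onto (verbatim the crux's triple).
[cite: Kato2004Asterisque, Thm. 12.5 (4) (p. 222)] -/
abbrev DoorAt (W : WeierstrassCurve ℚ) [W.IsElliptic] [W.IsGloballyMinimal] (p : ℕ) [Fact p.Prime] :
    Prop :=
  5 ≤ p ∧ IsOrdinaryAt W p ∧ W.HasSurjectiveModNGaloisRep p

/-- **`Z_k(W, p)`**: no admissible Kato zeta class is `T^k`-divisible up to a power of `p` (the crux's
tail with exponent `k`; the crux is `k = 2`). [cite: BurnsKuriharaSano2019, Lemma 6.12] -/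
def NoAdmissibleClassInTPow (W : WeierstrassCurve ℚ) [W.IsElliptic] [W.IsGloballyMinimal] (p : ℕ)
    [Fact p.Prime] [ContinuousSMul ℤ_[p] (W.tateModule p)] (k : ℕ) : Prop :=
  ∀ (K : ZpExtension ℚ p) (hK : K.IsCyclotomic) (γ : Field.absoluteGaloisGroup ℚ)
    (I : IwasawaH1Data W p K γ) (z₀ : I.H), K.IsTopGenerator γ → IsAdmissibleZetaClass W p K hK I z₀ →
      ¬ ∃ (h : I.H) (m : ℕ),
        ((p : IwasawaAlgebra p) ^ m) • z₀ = ((PowerSeries.X : IwasawaAlgebra p) ^ k) • h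

/-- **An admissible class exists at `(W, p)`** (the conclusion of route item `AdmissibleZetaClassExists`,
P-a; Kato Thm. 12.5 (1)+(4): `𝐳_γ ∈ 𝐇¹` under big image). [cite: Kato2004Asterisque, Thm. 12.5 (pp. 221–222)] -/
def AdmissibleClassExistsAt (W : WeierstrassCurve ℚ) [W.IsElliptic] [W.IsGloballyMinimal] (p : ℕ)
    [Fact p.Prime] [ContinuousSMul ℤ_[p] (W.tateModule p)] : Prop :=
  ∃ (K : ZpExtension ℚ p) (hK : K.IsCyclotomic) (γ : Field.absoluteGaloisGroup ℚ)
    (I : IwasawaH1Data W p K γ) (z₀ : I.H), K.IsTopGenerator γ ∧ IsAdmissibleZetaClass W p K hK I z₀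

/-- **Strict class**: an integral global class whose localisation at `p` vanishes modulo every `p^k`
(the classes counted by the route's support P1). [cite: BurnsKuriharaSano2019, Prop. 4.5] -/
def IsStrictClass (W : WeierstrassCurve ℚ) [W.IsElliptic] (p : ℕ) [Fact p.Prime]
    [ContinuousSMul ℤ_[p] (W.tateModule p)] (x : H1 (tateRep W p) ⊤) : Prop :=
  x ∈ integralH1 (tateRep W p) p ⊤ ∧ ∀ k : ℕ, locModPk W p k x = 0

/-- **`ℓ_T(M)`**: length at the height-one prime `(T)` of a `Λ`-module (same abbreviation as line
`lower`). [cite: Kato2004Asterisque, Conj. 12.10 (p. 224)] -/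
abbrev lengthAtT (p : ℕ) [Fact p.Prime] (M : Type) [AddCommGroup M] [Module (IwasawaAlgebra p) M] :
    ℕ∞ :=
  Module.lengthAt (IwasawaAlgebra p) M (IwasawaAlgebra.primeT p)

/-! ## §1 Reading of the crux; the one definitional lever -/

/-- The crux IS «`a = 2` ⇒ `Z₂` at door primes» (definitional). [folklore] -/
theorem derivedKatoDoor_iff :
    DerivedKatoDoor ↔
      ∀ (W : WeierstrassCurve ℚ) [W.IsElliptic] [W.IsGloballyMinimal] (p : ℕ) [Fact p.Prime]
        [ContinuousSMul ℤ_[p] (W.tateModule p)], W.analyticRank = 2 → DoorAt W p →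
        NoAdmissibleClassInTPow W p 2 :=
  Iff.rfl

/-- **Monotonicity in the exponent**: `Z_k ⇒ Z_{k+1}` (`T^{k+1} h = T^k (T h)`), so lowering the
exponent STRENGTHENS the crux. [folklore] -/
theorem noAdmissibleClassInTPow_succ {W : WeierstrassCurve ℚ} [W.IsElliptic] [W.IsGloballyMinimal]
    {p : ℕ} [Fact p.Prime] [ContinuousSMul ℤ_[p] (W.tateModule p)] {k : ℕ}
    (h : NoAdmissibleClassInTPow W p k) :
    NoAdmissibleClassInTPow W p (k + 1) := by
  intro K hK γ I z₀ hγ hz ⟨h', m, hm⟩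
  exact h K hK γ I z₀ hγ hz ⟨(PowerSeries.X : IwasawaAlgebra p) • h', m, by rw [hm, pow_succ, mul_smul]⟩

/-- `Z_k ⇒ Z_l` for `k ≤ l`. [folklore] -/
theorem noAdmissibleClassInTPow_mono {W : WeierstrassCurve ℚ} [W.IsElliptic] [W.IsGloballyMinimal]
    {p : ℕ} [Fact p.Prime] [ContinuousSMul ℤ_[p] (W.tateModule p)] {k l : ℕ} (hkl : k ≤ l)
    (h : NoAdmissibleClassInTPow W p k) : NoAdmissibleClassInTPow W p l := by
  induction l, hkl using Nat.le_induction with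
  | base => exact h
  | succ l _ ih => exact noAdmissibleClassInTPow_succ ih

/-- **The only definitional lever: `z₀ = 0`** satisfies `p^0 • 0 = T² • 0`, so the crux CONTAINS «no
admissible class is zero at an `a = 2` door prime» — Kato's non-vanishing Thm. 12.5 restricted there.
The lever is fenced in the tree: `IsAdmissibleZetaClass.ne_zero_of_forall_not_dvd_level` (Rohrlich) gives
`z₀ ≠ 0` as soon as `p ∤ level`, which good reduction at `p` supplies for the newform of `W`.  Hence
this `H` is not realisable; recorded to show where a junk refutation would have to come from.
[cite: Kato2004Asterisque, Thm. 12.5 (pp. 221–222)] -/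
theorem derivedKatoDoor_false_of_admissible_zero (W : WeierstrassCurve ℚ) [W.IsElliptic]
    [W.IsGloballyMinimal] (p : ℕ) [Fact p.Prime] [ContinuousSMul ℤ_[p] (W.tateModule p)]
    (ha : W.analyticRank = 2) (hdoor : DoorAt W p) (K : ZpExtension ℚ p) (hK : K.IsCyclotomic)
    (γ : Field.absoluteGaloisGroup ℚ) (I : IwasawaH1Data W p K γ) (hγ : K.IsTopGenerator γ)
    (h0 : IsAdmissibleZetaClass W p K hK I 0) : ¬ DerivedKatoDoor := fun hD =>
  hD W p ha hdoor K hK γ I 0 hγ h0 ⟨0, 0, by rw [smul_zero, smul_zero]⟩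

/-! ## §2 Mutants: load-bearing hypotheses and the tight exponent -/

/-- MUTANT «`a ≥ 2`»: the crux with `W.analyticRank = 2` weakened to `2 ≤ W.analyticRank`.
[cite: BurnsKuriharaSano2019, Prop. 4.5] -/
def DerivedKatoDoorFromTwo : Prop :=
  ∀ (W : WeierstrassCurve ℚ) [W.IsElliptic] [W.IsGloballyMinimal] (p : ℕ) [Fact p.Prime]
    [ContinuousSMul ℤ_[p] (W.tateModule p)], 2 ≤ W.analyticRank → DoorAt W p →
    NoAdmissibleClassInTPow W p 2

/-- MUTANT «`v = 0` at `a = 2`»: the exponent `2` lowered to `1` (a STRENGTHENING, next lemma).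
[cite: BurnsKuriharaSano2019, Prop. 4.5] -/
def DerivedKatoDoorStrongZero : Prop :=
  ∀ (W : WeierstrassCurve ℚ) [W.IsElliptic] [W.IsGloballyMinimal] (p : ℕ) [Fact p.Prime]
    [ContinuousSMul ℤ_[p] (W.tateModule p)], W.analyticRank = 2 → DoorAt W p →
    NoAdmissibleClassInTPow W p 1

/-- MUTANT without «good ordinary»: door = `5 ≤ p ∧ ρ̄ onto` (multiplicative and supersingular `p`
admitted). [cite: Kato2004Asterisque, Thm. 12.4 (p. 221)] -/
def DerivedKatoDoorWithoutOrdinary : Prop :=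
  ∀ (W : WeierstrassCurve ℚ) [W.IsElliptic] [W.IsGloballyMinimal] (p : ℕ) [Fact p.Prime]
    [ContinuousSMul ℤ_[p] (W.tateModule p)], W.analyticRank = 2 →
    (5 ≤ p ∧ W.HasSurjectiveModNGaloisRep p) → NoAdmissibleClassInTPow W p 2

/-- MUTANT without «`ρ̄` onto»: door = `5 ≤ p ∧` good ordinary. [cite: Kato2004Asterisque, Thm. 12.5 (4) (p. 222)] -/
def DerivedKatoDoorWithoutSurjective : Prop :=
  ∀ (W : WeierstrassCurve ℚ) [W.IsElliptic] [W.IsGloballyMinimal] (p : ℕ) [Fact p.Prime]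
    [ContinuousSMul ℤ_[p] (W.tateModule p)], W.analyticRank = 2 →
    (IsOrdinaryAt W p ∧ W.HasSurjectiveModNGaloisRep p) → NoAdmissibleClassInTPow W p 2

/-- MUTANT without «`5 ≤ p`»: every good ordinary big-image prime. [cite: Kato2004Asterisque, Thm. 12.5 (4) (p. 222)] -/
def DerivedKatoDoorWithoutFive : Prop :=
  ∀ (W : WeierstrassCurve ℚ) [W.IsElliptic] [W.IsGloballyMinimal] (p : ℕ) [Fact p.Prime]
    [ContinuousSMul ℤ_[p] (W.tateModule p)], W.analyticRank = 2 →
    (IsOrdinaryAt W p ∧ W.HasSurjectiveModNGaloisRep p) → NoAdmissibleClassInTPow W p 2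

/-- `FromTwo ⇒ crux`. [folklore] -/
theorem derivedKatoDoor_of_fromTwo (h : DerivedKatoDoorFromTwo) : DerivedKatoDoor :=
  fun W _ _ p _ _ ha hdoor => h W p ha.ge hdoor

/-- `StrongZero ⇒ crux` (exponent monotonicity): «v = 0» is a strengthening. [folklore] -/
theorem derivedKatoDoor_of_strongZero (h : DerivedKatoDoorStrongZero) : DerivedKatoDoor :=
  fun W _ _ p _ _ ha hdoor => noAdmissibleClassInTPow_succ (h W p ha hdoor)

/-- `WithoutOrdinary ⇒ crux`. [folklore] -/
theorem derivedKatoDoor_of_withoutOrdinary (h : DerivedKatoDoorWithoutOrdinary) : DerivedKatoDoor :=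
  fun W _ _ p _ _ ha hdoor => h W p ha ⟨hdoor.1, hdoor.2.2⟩

/-- `WithoutSurjective`-shaped weakening of the door (both remaining conjuncts kept) `⇒ crux`. [folklore] -/
theorem derivedKatoDoor_of_withoutFive (h : DerivedKatoDoorWithoutFive) : DerivedKatoDoor :=
  fun W _ _ p _ _ ha hdoor => h W p ha hdoor.2

/-- (★₀) — **the route's P1 one notch lower** (print, same mechanism: Kato's divisibility Thm. 12.5 (4) +
`𝐇² ↠ H²(ℤ_S, T)_tf`, the proof of BKS Prop. 4.5 with `a = 0`): at a door prime, ONE admissible class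
with `v_T = 0` forces the strict part to be TORSION (strict rank `0`).
[cite: BurnsKuriharaSano2019, Prop. 4.5] [cite: Kato2004Asterisque, Thm. 12.5 (4) (p. 222)] -/
def StrictRankZeroOfOrderZero : Prop :=
  ∀ (W : WeierstrassCurve ℚ) [W.IsElliptic] [W.IsGloballyMinimal] (p : ℕ) [Fact p.Prime]
    [ContinuousSMul ℤ_[p] (W.tateModule p)], DoorAt W p →
    (∃ (K : ZpExtension ℚ p) (hK : K.IsCyclotomic) (γ : Field.absoluteGaloisGroup ℚ)
      (I : IwasawaH1Data W p K γ) (z₀ : I.H), K.IsTopGenerator γ ∧ IsAdmissibleZetaClass W p K hK I z₀ ∧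
      ¬ ∃ (h : I.H) (m : ℕ),
        ((p : IwasawaAlgebra p) ^ m) • z₀ = ((PowerSeries.X : IwasawaAlgebra p) ^ 1) • h) →
    ∀ x : H1 (tateRep W p) ⊤, IsStrictClass W p x → ∃ a : ℤ_[p], a ≠ 0 ∧ a • x = 0

/-- **KILL CRITERION (K-i), typed through the route's own support P1 (`StrictRankLeDerivedOrder`, BKS
Prop. 4.5 contrapositive):** an analytic-rank-two curve with a door prime `p`, an admissible class, and
TWO `ℤ_p`-INDEPENDENT strict classes refutes the crux.  At `a = 2` one rational point already makes the
strict rank `s_p − 1`, so this `H` says `s_p ≥ 3` — it VIOLATES BSD (+ finiteness of `Ш[p^∞]`); it is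
the failure mode the E-S0-1 atlas watches (`A > 2`), absent in all 21 680 certified cells (j314427).
Not a refutation: `H` is neither constructible nor expected. [cite: BurnsKuriharaSano2019, Prop. 4.5] -/
theorem derivedKatoDoor_false_of_strictIndependentPair (hP1 : StrictRankLeDerivedOrder)
    (W : WeierstrassCurve ℚ) [W.IsElliptic] [W.IsGloballyMinimal] (p : ℕ) [Fact p.Prime]
    [ContinuousSMul ℤ_[p] (W.tateModule p)] (ha : W.analyticRank = 2) (hdoor : DoorAt W p)
    (hadm : AdmissibleClassExistsAt W p) (x y : H1 (tateRep W p) ⊤) (hx : IsStrictClass W p x)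
    (hy : IsStrictClass W p y) (hind : ∀ a b : ℤ_[p], a • x + b • y = 0 → a = 0 ∧ b = 0) :
    ¬ DerivedKatoDoor := by
  intro hD
  obtain ⟨K, hK, γ, I, z₀, hγ, hz⟩ := hadm
  obtain ⟨a, b, hab, h0⟩ := hP1 W p hdoor ⟨K, hK, γ, I, z₀, hγ, hz, hD W p ha hdoor K hK γ I z₀ hγ hz⟩
    x y hx.1 hy.1 hx.2 hy.2
  obtain ⟨rfl, rfl⟩ := hind a b h0
  exact hab.elim (fun h => h rfl) (fun h => h rfl)

/-- **`W.analyticRank = 2` is LOAD-BEARING — the mutant «`a ≥ 2`» is false modulo `H`** = P1 + ONE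
curve of analytic rank `≥ 2` with a door prime, an admissible class and two independent strict classes.
PRINT supplies `H` at `a = 3`: 5077a has three independent points, so the strict part (kernel of
`E(ℚ) ⊗ ℤ_p → E(ℚ_p) ⊗̂ ℤ_p ≅ ℤ_p ⊕ finite` on a rank-3 lattice) has rank `≥ 2` UNCONDITIONALLY, and
5077a (prime conductor, no isogeny) has door primes; analytic rank `3` is Buhler–Gross–Zagier.  So
`DerivedKatoDoorFromTwo` is false in print (`v ≥ 2` there, BKS Prop. 4.5), while `H` is not
constructible in the tree (analytic rank, admissible realisability).  Any proof of the crux must use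
`a = 2` (not merely `a ≥ 2`). [cite: BurnsKuriharaSano2019, Prop. 4.5] -/
theorem derivedKatoDoorFromTwo_false_of_strictIndependentPair (hP1 : StrictRankLeDerivedOrder)
    (W : WeierstrassCurve ℚ) [W.IsElliptic] [W.IsGloballyMinimal] (p : ℕ) [Fact p.Prime]
    [ContinuousSMul ℤ_[p] (W.tateModule p)] (ha : 2 ≤ W.analyticRank) (hdoor : DoorAt W p)
    (hadm : AdmissibleClassExistsAt W p) (x y : H1 (tateRep W p) ⊤) (hx : IsStrictClass W p x)
    (hy : IsStrictClass W p y) (hind : ∀ a b : ℤ_[p], a • x + b • y = 0 → a = 0 ∧ b = 0) :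
    ¬ DerivedKatoDoorFromTwo := by
  intro hD
  obtain ⟨K, hK, γ, I, z₀, hγ, hz⟩ := hadm
  obtain ⟨a, b, hab, h0⟩ := hP1 W p hdoor ⟨K, hK, γ, I, z₀, hγ, hz, hD W p ha hdoor K hK γ I z₀ hγ hz⟩
    x y hx.1 hy.1 hx.2 hy.2
  obtain ⟨rfl, rfl⟩ := hind a b h0
  exact hab.elim (fun h => h rfl) (fun h => h rfl)

/-- **The exponent `2` is TIGHT — «`v = 0` at `a = 2`» is false modulo `H`** = (★₀) + ONE analytic-rank-two
curve with a door prime, an admissible class and ONE non-torsion strict class.  PRINT supplies `H` at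
every rank-two curve (two points ⇒ strict rank `≥ 1` unconditionally; e.g. (389a1, 5): `a_5 = −3`,
image maximal, analytic rank `2` exact by sign + `L(E,1) = 0` + `L''(E,1) ≠ 0`), so
`DerivedKatoDoorStrongZero` is false in print: `v_T(z₀) ≥ 1` always at `a = 2` ([KP07, Prop. 3.1]:
`char ⊂ (∏ Φ_n^{e_n − 1})`, here `e_0 ≥ 2`).  In the tree `H` is not constructible (analytic rank;
P-a). [cite: BurnsKuriharaSano2019, Prop. 4.5] [cite: KuriharaPollack2007, §3.1 Prop. 3.1] -/
theorem derivedKatoDoorStrongZero_false_of (hStar0 : StrictRankZeroOfOrderZero)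
    (W : WeierstrassCurve ℚ) [W.IsElliptic] [W.IsGloballyMinimal] (p : ℕ) [Fact p.Prime]
    [ContinuousSMul ℤ_[p] (W.tateModule p)] (ha : W.analyticRank = 2) (hdoor : DoorAt W p)
    (hadm : AdmissibleClassExistsAt W p) (x : H1 (tateRep W p) ⊤) (hx : IsStrictClass W p x)
    (hfree : ∀ a : ℤ_[p], a • x = 0 → a = 0) : ¬ DerivedKatoDoorStrongZero := by
  intro hD
  obtain ⟨K, hK, γ, I, z₀, hγ, hz⟩ := hadm
  obtain ⟨a, ha0, hax⟩ :=
    hStar0 W p hdoor ⟨K, hK, γ, I, z₀, hγ, hz, hD W p ha hdoor K hK γ I z₀ hγ hz⟩ x hx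
  exact ha0 (hfree a hax)

/-! ## §3 The BSD-consistent failure mode, typed: a `T²`-Jordan block in the fine Selmer dual -/

/-- **Kato's divisibility at the prime `(T)`** (PRINT, PROVED in print — not the open IMC direction):
at a door prime, for every admissible `z₀`, `ℓ_T(X₀(E/ℚ_∞)) ≤ ℓ_T(𝐇¹/Λz₀)`.  Ingredients: Kato Thm.
12.5 (4) / 17.4 (`char 𝐇² ⊇ char(𝐇¹/Z)` under big image), `Z_(T) = Λ_(T) z₀` (the admissible multiplier
is a unit at `(T)`), and `X₀ ↪ 𝐇²` with finite cokernel (Poitou–Tate; tree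
`exists_iwasawaH2Data_fineSelmerDual_embedding`). [cite: Kato2004Asterisque, Thm. 12.5 (4) (p. 222), §13 and §17.13 (p. 279)] -/
def KatoDivisibilityAtT : Prop :=
  ∀ (W : WeierstrassCurve ℚ) [W.IsElliptic] [W.IsGloballyMinimal] (p : ℕ) [Fact p.Prime]
    [ContinuousSMul ℤ_[p] (W.tateModule p)], DoorAt W p →
    ∀ (K : ZpExtension ℚ p) (hK : K.IsCyclotomic) (γ : Field.absoluteGaloisGroup ℚ)
      (I : IwasawaH1Data W p K γ) (z₀ : I.H) (hγ : K.IsTopGenerator γ),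
      IsAdmissibleZetaClass W p K hK I z₀ →
        lengthAtT p (W.fineSelmerDualData K hγ).X ≤
          lengthAtT p (I.H ⧸ Submodule.span (IwasawaAlgebra p) {z₀})

/-- **`T`-saturation in `𝐇¹`** (ALGEBRA modulo Kato Thm. 12.4 (3): at a door prime `𝐇¹` is free of
rank one, `𝐇¹ = Λ c`, `z₀ = f c`, `ℓ_T(𝐇¹/Λz₀) = ord_T f`, and `T² ∣ p^m f ⟺ T² ∣ f` in the UFD `Λ`;
for torsion-free rank one the same holds through the reflexive hull): `2 ≤ ℓ_T(𝐇¹/Λz₀)` ⇒ some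
`p^m z₀ ∈ T² 𝐇¹` — the converse of the lower line's stub L1 at `k = 2`.
[cite: Kato2004Asterisque, Thm. 12.4 (2)(3) (p. 221)] -/
def TSaturatedAtTwo : Prop :=
  ∀ (W : WeierstrassCurve ℚ) [W.IsElliptic] [W.IsGloballyMinimal] (p : ℕ) [Fact p.Prime]
    [ContinuousSMul ℤ_[p] (W.tateModule p)], DoorAt W p →
    ∀ (K : ZpExtension ℚ p), K.IsCyclotomic → ∀ (γ : Field.absoluteGaloisGroup ℚ)
      (I : IwasawaH1Data W p K γ) (z₀ : I.H), K.IsTopGenerator γ →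
      (2 : ℕ∞) ≤ lengthAtT p (I.H ⧸ Submodule.span (IwasawaAlgebra p) {z₀}) →
        ∃ (h : I.H) (m : ℕ),
          ((p : IwasawaAlgebra p) ^ m) • z₀ = ((PowerSeries.X : IwasawaAlgebra p) ^ 2) • h

/-- **KILL CRITERION (K-ii) — the BSD-CONSISTENT one:** modulo Kato's divisibility at `(T)` and
`T`-saturation (both print/algebra), ONE analytic-rank-two curve with a door prime `p`, a cyclotomic datum
with `2 ≤ ℓ_T(X₀(E/ℚ_∞))` and an admissible class for that datum refutes the crux.  Under BSD the
`T`-part of `X₀` has exactly one block (`rank X₀/TX₀ = s = 1`), so `2 ≤ ℓ_T(X₀)` means a block `Λ/T^e`,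
`e ≥ 2`: a failure of Greenberg's semisimplicity conjecture for the fine Selmer dual ([KP07, Problem 0.7,
Problem 3.2]; [Lim22, Conj. 4.2]).  No such example is in print; Lim's criterion (λ = corank Sel(E/ℚ_n))
certifies semisimplicity in the computed cases; the atlas (A = 2 in 21 680 cells) excludes it below
`N < 10⁴`, `p ≤ 47` modulo IMC.  This is the crux's genuine open content.
[cite: KuriharaPollack2007, Problem 0.7 and §3.1 Problem 3.2] [cite: Lim2022OrderVanishing, Conj. 4.2 and Lemma 4.4]
[cite: Kato2004Asterisque, Conj. 12.10 (p. 224)] -/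
theorem derivedKatoDoor_false_of_fineLength_two (hdiv : KatoDivisibilityAtT) (hsat : TSaturatedAtTwo)
    (W : WeierstrassCurve ℚ) [W.IsElliptic] [W.IsGloballyMinimal] (p : ℕ) [Fact p.Prime]
    [ContinuousSMul ℤ_[p] (W.tateModule p)] (ha : W.analyticRank = 2) (hdoor : DoorAt W p)
    (K : ZpExtension ℚ p) (hK : K.IsCyclotomic) (γ : Field.absoluteGaloisGroup ℚ)
    (hγ : K.IsTopGenerator γ) (hX : (2 : ℕ∞) ≤ lengthAtT p (W.fineSelmerDualData K hγ).X)
    (hadm : ∃ (I : IwasawaH1Data W p K γ) (z₀ : I.H), IsAdmissibleZetaClass W p K hK I z₀) :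
    ¬ DerivedKatoDoor := by
  intro hD
  obtain ⟨I, z₀, hz⟩ := hadm
  exact hD W p ha hdoor K hK γ I z₀ hγ hz
    (hsat W p hdoor K hK γ I z₀ hγ (hX.trans (hdiv W p hdoor K hK γ I z₀ hγ hz)))

/-! ## §3b `T`-saturation PROVED modulo the named fact `Kato2004.thm12_4` (landed copy: `Negative/TSaturation.lean`) -/

/-- **`ord_T` detects `T`-divisibility in a free rank-one `Λ`-module** (ALGEBRA, proved): if `H ≅ Λ`
and `k ≤ ℓ_T(H/Λz₀)` then `z₀ ∈ T^k H` (transport along a basis, `H/Λz₀ ≅ Λ/(f)`, then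
`Module.pow_dvd_of_le_lengthAt_quotient` with `PowerSeries.X_prime`).  The converse of the lead's L1 in
the free case. [cite: Washington1997, §13.2] -/
theorem exists_eq_X_pow_smul_of_le_lengthAtT {p : ℕ} [Fact p.Prime] {H : Type}
    [AddCommGroup H] [Module (IwasawaAlgebra p) H] [Module.Free (IwasawaAlgebra p) H]
    (hrank : Module.finrank (IwasawaAlgebra p) H = 1) (z₀ : H) {k : ℕ}
    (hk : (k : ℕ∞) ≤ lengthAtT p (H ⧸ Submodule.span (IwasawaAlgebra p) {z₀})) :
    ∃ h : H, z₀ = ((PowerSeries.X : IwasawaAlgebra p) ^ k) • h := by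
  classical
  by_cases hz : z₀ = 0
  · exact ⟨0, by rw [hz, smul_zero]⟩
  let e : H ≃ₗ[IwasawaAlgebra p] IwasawaAlgebra p :=
    (Module.basisUnique (Fin 1) hrank).repr.trans
      (Finsupp.uniqueLinearEquiv (IwasawaAlgebra p) (IwasawaAlgebra p) (0 : Fin 1))
  have hf0 : e z₀ ≠ 0 := fun h0 => hz (e.injective (by rw [h0, map_zero]))
  have hmap : (Submodule.span (IwasawaAlgebra p) {z₀}).map
      (e : H →ₗ[IwasawaAlgebra p] IwasawaAlgebra p) = Ideal.span {e z₀} := by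
    rw [Submodule.map_span]
    show Submodule.span (IwasawaAlgebra p) ((fun x => e x) '' {z₀}) = Ideal.span {e z₀}
    rw [Set.image_singleton]
  have eq : (H ⧸ Submodule.span (IwasawaAlgebra p) {z₀}) ≃ₗ[IwasawaAlgebra p]
      (IwasawaAlgebra p ⧸ Ideal.span {e z₀}) :=
    Submodule.Quotient.equiv _ _ e hmap
  unfold lengthAtT at hk
  rw [Module.lengthAt_eq_of_linearEquiv eq] at hk
  obtain ⟨g, hg⟩ := Module.pow_dvd_of_le_lengthAt_quotient PowerSeries.X_prime hf0
    (IwasawaAlgebra.primeT p) (IwasawaAlgebra.primeT_asIdeal p) hk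
  refine ⟨e.symm g, e.injective ?_⟩
  rw [map_smul, LinearEquiv.apply_symm_apply, smul_eq_mul, ← hg]

/-- **`TSaturatedAtTwo` holds modulo `Kato2004.thm12_4`** (Thm. 12.4 (3): `p ≠ 2`, `E[p]` irreducible ⇒
`𝐇¹` free of rank one; at a door prime `5 ≤ p` and `ρ̄` onto ⇒ irreducible, tree
`hasIrreducibleModPGaloisRep_of_hasSurjectiveModNGaloisRep`); indeed with `m = 0`.
[cite: Kato2004Asterisque, Thm. 12.4 (3) (p. 221)] -/
theorem tSaturatedAtTwo_of_thm12_4 (h124 : Kato2004.thm12_4) : TSaturatedAtTwo := by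
  intro W _ _ p _ _ hdoor K hK γ I z₀ hγ h2
  have hp2 : p ≠ 2 := by have := hdoor.1; omega
  haveI : NeZero (p : ℚ) := ⟨Nat.cast_ne_zero.mpr (Fact.out : p.Prime).ne_zero⟩
  have hirr : W.HasIrreducibleModPGaloisRep p :=
    hasIrreducibleModPGaloisRep_of_hasSurjectiveModNGaloisRep W p hdoor.2.2
  obtain ⟨_, hrank⟩ := (h124 W p K γ hK hγ I).2.2 hp2 hirr
  obtain ⟨h, hh⟩ := exists_eq_X_pow_smul_of_le_lengthAtT hrank z₀ (k := 2) h2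
  exact ⟨h, 0, by rw [pow_zero, one_smul, hh]⟩

/-- **(K-ii) with saturation discharged:** modulo `Kato2004.thm12_4` (named tree fact) and Kato's
divisibility at `(T)` (proved in print), one analytic-rank-two door cell with `2 ≤ ℓ_T(X₀(E/ℚ_∞))`
(a `T²`-Jordan block: Greenberg semisimplicity failure) and an admissible class refutes the crux.
Settles nothing. [cite: KuriharaPollack2007, Problem 0.7] [cite: Lim2022OrderVanishing, Conj. 4.2] -/
theorem derivedKatoDoor_false_of_fineLength_two_of_thm12_4 (h124 : Kato2004.thm12_4)
    (hdiv : KatoDivisibilityAtT)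
    (W : WeierstrassCurve ℚ) [W.IsElliptic] [W.IsGloballyMinimal] (p : ℕ) [Fact p.Prime]
    [ContinuousSMul ℤ_[p] (W.tateModule p)] (ha : W.analyticRank = 2) (hdoor : DoorAt W p)
    (K : ZpExtension ℚ p) (hK : K.IsCyclotomic) (γ : Field.absoluteGaloisGroup ℚ)
    (hγ : K.IsTopGenerator γ) (hX : (2 : ℕ∞) ≤ lengthAtT p (W.fineSelmerDualData K hγ).X)
    (hadm : ∃ (I : IwasawaH1Data W p K γ) (z₀ : I.H), IsAdmissibleZetaClass W p K hK I z₀) :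
    ¬ DerivedKatoDoor :=
  derivedKatoDoor_false_of_fineLength_two hdiv (tSaturatedAtTwo_of_thm12_4 h124) W p ha hdoor K hK γ
    hγ hX hadm

/-! ## §4 Line `lower` (PICKED) — targets and joint sufficiency

`-- Targets`: the lead's STUCK list is empty at this boundary; the registered stubs are L1
`stub_depthLeQuotientLength` (algebra; TRUE — torsion-freeness `IwasawaH1Data.isTorsionFree` makes
`Λ_(T) h / T^k ↪ (𝐇¹/Λz₀)_(T)` of length `k`, and the claim is trivially true in the junk regime
`ℓ_T = ⊤`), L2 `stub_quotientLengthLeFineLength` (PRINT: BCS IMC + Kato 17.13/12.5; the OPPOSITE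
inequality to `KatoDivisibilityAtT`), L3 `stub_fineLengthLeOneOfAnalyticRankTwo` (OPEN), L4 the rung. -/

/-- Line `lower`'s open stub L3, verbatim (`Lines/lower.lean` :198, commit 2415d15459c5).
[cite: Kato2004Asterisque, Conj. 12.10 (p. 224)] -/
def LowerL3 : Prop :=
  ∀ (W : WeierstrassCurve ℚ) [W.IsElliptic] [W.IsGloballyMinimal] (p : ℕ) [Fact p.Prime]
    [ContinuousSMul ℤ_[p] (W.tateModule p)], W.analyticRank = 2 →
    (5 ≤ p ∧ IsOrdinaryAt W p ∧ W.HasSurjectiveModNGaloisRep p) →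
    ∀ (K : ZpExtension ℚ p), K.IsCyclotomic →
      ∀ (γ : Field.absoluteGaloisGroup ℚ) (hγ : K.IsTopGenerator γ),
        Module.lengthAt (IwasawaAlgebra p) (W.fineSelmerDualData K hγ).X (IwasawaAlgebra.primeT p) ≤ 1

/-- Line `lower`'s algebra stub L1, verbatim as a `Prop`. [cite: Kato2004Asterisque, Thm. 12.4 (2) (p. 221)] -/
def LowerL1 : Prop :=
  ∀ (W : WeierstrassCurve ℚ) [W.IsElliptic] (p : ℕ) [Fact p.Prime]
    [ContinuousSMul ℤ_[p] (W.tateModule p)]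
    (K : ZpExtension ℚ p) (γ : Field.absoluteGaloisGroup ℚ) (I : IwasawaH1Data W p K γ) (z₀ : I.H),
    K.IsTopGenerator γ → z₀ ≠ 0 → ∀ k : ℕ,
    (∃ (h : I.H) (m : ℕ),
      ((p : IwasawaAlgebra p) ^ m) • z₀ = ((PowerSeries.X : IwasawaAlgebra p) ^ k) • h) →
    (k : ℕ∞) ≤ Module.lengthAt (IwasawaAlgebra p) (I.H ⧸ Submodule.span (IwasawaAlgebra p) {z₀})
      (IwasawaAlgebra.primeT p)

/-- Line `lower`'s print stub L2, verbatim as a `Prop`. [cite: BurungaleCastellaSkinner2024, Thm. 1.1.2]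
[cite: Kato2004Asterisque, Conj. 12.10 (p. 224), §17.13 (p. 279)] -/
def LowerL2 : Prop :=
  ∀ (W : WeierstrassCurve ℚ) [W.IsElliptic] [W.IsGloballyMinimal] (p : ℕ) [Fact p.Prime]
    [ContinuousSMul ℤ_[p] (W.tateModule p)],
    (5 ≤ p ∧ IsOrdinaryAt W p ∧ W.HasSurjectiveModNGaloisRep p) →
    ∀ (K : ZpExtension ℚ p) (hK : K.IsCyclotomic) (γ : Field.absoluteGaloisGroup ℚ)
      (I : IwasawaH1Data W p K γ) (z₀ : I.H) (hγ : K.IsTopGenerator γ),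
      IsAdmissibleZetaClass W p K hK I z₀ →
      z₀ ≠ 0 ∧
        Module.lengthAt (IwasawaAlgebra p) (I.H ⧸ Submodule.span (IwasawaAlgebra p) {z₀})
            (IwasawaAlgebra.primeT p) ≤
          Module.lengthAt (IwasawaAlgebra p) (W.fineSelmerDualData K hγ).X (IwasawaAlgebra.primeT p)

/-- **What kills L3** ((K-ii) verbatim, no `H` at all): one analytic-rank-two curve, a door prime and a
cyclotomic datum with `2 ≤ ℓ_T(X₀)`. Neither constructible (analytic rank) nor in print (Greenberg
semisimplicity has no known failure). [cite: KuriharaPollack2007, Problem 0.7] [cite: Lim2022OrderVanishing, Conj. 4.2] -/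
theorem lowerL3_false_of_fineLength_two (W : WeierstrassCurve ℚ) [W.IsElliptic] [W.IsGloballyMinimal]
    (p : ℕ) [Fact p.Prime] [ContinuousSMul ℤ_[p] (W.tateModule p)] (ha : W.analyticRank = 2)
    (hdoor : DoorAt W p) (K : ZpExtension ℚ p) (hK : K.IsCyclotomic) (γ : Field.absoluteGaloisGroup ℚ)
    (hγ : K.IsTopGenerator γ) (hX : (2 : ℕ∞) ≤ lengthAtT p (W.fineSelmerDualData K hγ).X) :
    ¬ LowerL3 := fun hL3 => by
  have h21 : (2 : ℕ∞) ≤ 1 := hX.trans (hL3 W p ha hdoor K hK γ hγ)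
  exact absurd h21 (by decide)

/-- **Joint sufficiency, read backwards (no gap smuggled by `DerivedKatoDoor_of`):** given the algebra
stub L1 and the print stub L2, a KILL of the crux kills L3 — the open stub is NECESSARY for the line
modulo its own print imports; and by `derivedKatoDoor_false_of_fineLength_two` an L3-kill kills the
crux modulo Kato's divisibility + saturation + P-a.  So L3 ≡ crux modulo print in both directions: the
lower line neither loses nor adds open content (contrast `birth`, whose open stub adds C₂' ∧ ε).
[cite: Kato2004Asterisque, Conj. 12.10 (p. 224)] -/
theorem not_lowerL3_of_not_derivedKatoDoor (hL1 : LowerL1) (hL2 : LowerL2) (hD : ¬ DerivedKatoDoor) :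
    ¬ LowerL3 := by
  intro hL3
  apply hD
  intro W _ _ p _ _ ha hdoor K hK γ I z₀ hγ hz hdiv
  obtain ⟨hne, hle⟩ := hL2 W p hdoor K hK γ I z₀ hγ hz
  have h2 := hL1 W p K γ I z₀ hγ hne 2 hdiv
  have h21 : ((2 : ℕ) : ℕ∞) ≤ 1 := h2.trans (hle.trans (hL3 W p ha hdoor K hK γ hγ))
  exact absurd (by exact_mod_cast h21 : (2 : ℕ) ≤ 1) (by omega)

/-- **L2 and Kato's divisibility together pin `ℓ_T(𝐇¹/Λz₀) = ℓ_T(X₀)`** at door primes (the `(T)`-part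
of Kato's Conj. 12.10 as an equality) — recorded so that the line's print import is seen to be EXACTLY
the IMC at `(T)`, nothing weaker would do for L2. [cite: Kato2004Asterisque, Conj. 12.10 (p. 224)] -/
theorem lengthAtT_quotient_eq_fineLength (hL2 : LowerL2) (hdiv : KatoDivisibilityAtT)
    (W : WeierstrassCurve ℚ) [W.IsElliptic] [W.IsGloballyMinimal] (p : ℕ) [Fact p.Prime]
    [ContinuousSMul ℤ_[p] (W.tateModule p)] (hdoor : DoorAt W p) (K : ZpExtension ℚ p)
    (hK : K.IsCyclotomic) (γ : Field.absoluteGaloisGroup ℚ) (I : IwasawaH1Data W p K γ) (z₀ : I.H)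
    (hγ : K.IsTopGenerator γ) (hz : IsAdmissibleZetaClass W p K hK I z₀) :
    lengthAtT p (I.H ⧸ Submodule.span (IwasawaAlgebra p) {z₀}) =
      lengthAtT p (W.fineSelmerDualData K hγ).X :=
  le_antisymm (hL2 W p hdoor K hK γ I z₀ hγ hz).2 (hdiv W p hdoor K hK γ I z₀ hγ hz)

/-! ## HANDOFF (cycle 1, 2026-08-28)
* Landed under `Theorems/DerivedKatoDoor/Negative/`: `LoadBearing.lean` (the §2–§4 lemmas, def-free;
  p658113 ACCEPTED, commit 6ee03bf10960); `TSaturation.lean` (§3b, def-free: the free-rank-one algebra,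
  saturation from `thm12_4`, (K-ii) modulo `thm12_4` + divisibility at `(T)`) — proposal id on the crux
  item's evidence / the seat's NOTES.
* Sorried here: nothing.  Route rev 4 (18:58Z) added riders `ColemanStepDoor` (23145), `ZetaDepthPosAt`,
  `ColemanStepPosAt` (23147), `CrisAtDoorPrimes` (23148): `ZetaDepthPosAt` («v ≥ 1») is exactly the
  negation-pointwise of the exponent-1 mutant `DerivedKatoDoorStrongZero` shown false in print in §2 —
  consistent; none of them is this seat's target.
* Next regimes: (1) if the lead posts STUCK stubs, attack their exact signatures first; (2) a
  `kit` toy is pointless for (K-i) (atlas) — for (K-ii) the computable proxy is Lim's criterion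
  `λ(X(E/ℚ_∞)) = corank Sel(E/ℚ_n)` on Wuthrich-type rank-2 examples at door primes (needs λ of the
  ordinary Selmer dual = λ(L_p) by IMC: ONE batched job over the atlas rows with λ(L_p) > 2 would list
  every cell where a non-semisimple T-block is even possible: cells with λ = 2 are automatically
  semisimple-at-T with v = 1); (3) `p = 3` big-image cells as a misstatement probe of `5 ≤ p` (none
  expected).
-/

end Summit.BirchSwinnertonDyer.BirchSwinnertonDyer.Cruxes.DerivedKatoDoor.Disproof

end
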